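import Literature.NumberTheory.EllipticCurves.PadicPointsFiltrationProofs
import Literature.NumberTheory.EllipticCurves.VariableChangePoints
import Literature.NumberTheory.EllipticCurves.BhargavaShankarEq31Proofs
import HarnessLib

/-!
# `E(ℚ_p)` has a finite-index subgroup isomorphic to `ℤ_p` (Silverman AEC VII.6.3), and
# Brumer–Kramer (Bhargava–Shankar Lemma 5.16) — discharges of two named facts

Trunk T-NT-EC (Literature/NumberTheory/EllipticCurves). Third of three files; proofs only.
DISCHARGES `Literature.NumberTheory.EllipticCurves.exists_finiteIndex_addEquiv_padicInt`
(`BhargavaShankarCounting.lean`: Silverman AEC Prop. VII.6.3 for `K = ℚ_p`) as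
`exists_finiteIndex_addEquiv_padicInt_holds`, hence
`Literature.NumberTheory.EllipticCurves.brumerKramer_card_quotient_two` (Bhargava–Shankar,
Lemma 5.16 = Brumer–Kramer: `#E(ℚ_p)/2E(ℚ_p) = c_p·#E(ℚ_p)[2]`) as
`brumerKramer_card_quotient_two_holds` through the tree's `brumerKramer_card_quotient_two_of_AEC`.
After this file Bhargava–Shankar's Cor. 1.2 (`averageRankLE_three_halves`) rests on exactly three
named inputs (Lemma 5.2, the sieve step of display (31), Thm. 2.1):
`averageRankLE_three_halves_of_three_sieve_facts`.

## The argument (for a `p`-integral equation; the general case by a scaling)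

With `E⁽ⁿ⁾(ℚ_p) = W.formalFiltration n ≃+ ℤ_p` for `n ≥ 2` (`PadicPointsFiltrationProofs.lean`) it
remains to see that `E⁽ⁿ⁾` has finite index in `E(ℚ_p)`. Instead of AEC's chain
`E(K) ⊃ E₀(K) ⊃ E₁(K)` (VII.6.1/compactness and VII.2.1, neither in the tree) one elementary
estimate suffices: the map sending `P ∈ E₁(ℚ_p)` to `z(P) mod pⁿ` and an integral point `(x, y)`
to `(x, y) mod p^M` has finitely many values, and its fibres lie in cosets of `E⁽ⁿ⁾`
(`finiteIndex_formalFiltration`, via the coset criterion `addSubgroup_finiteIndex_of_fibers`):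
* on `E₁(ℚ_p)` because `‖z(P - Q)‖ ≤ ‖z(P) - z(Q)‖` (`sub_mem_formalFiltration_of_norm_sub_le`);
* on integral points because two of them congruent modulo `p^M` with `p⁻ᴹ < ‖Δ‖p⁻ⁿ⁻¹` differ by
  an element of `E⁽ⁿ⁾` (`some_sub_some_mem_formalFiltration`): the line computing `P - Q` has
  slope `λ` with `‖λ‖ ≥ ‖Δ‖/ε` (`le_norm_slope_of_near`), by subtracting the two Weierstrass
  equations and the bound **`‖Δ‖ ≤ max(‖W_Y(x,y)‖, ‖W_X(x,y)‖)`** at an integral point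
  (`norm_Δ_le_max_partial_padic`, from the explicit membership `Δ ∈ (a₃, a₄, a₆)`,
  `Δ_eq_a₃_mul_add_a₄_mul_add_a₆_mul`, applied to the translate of the curve by the point); then
  `‖x(P - Q)‖ = ‖λ‖² > 1` and `‖z(P - Q)‖ = ‖λ‖⁻¹ ≤ p⁻ⁿ`.
Finally `exists_finiteIndex_addEquiv_padicInt_holds`: Mathlib's `exists_isIntegral` gives a scaling
`C` with `C • W` integral, and the tree's `VariableChange.pointEquiv W C : W(ℚ_p) ≃+ (C • W)(ℚ_p)`
transports the subgroup.

## Sources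

* J. H. Silverman, *The Arithmetic of Elliptic Curves*, 2nd ed. (2009), III.1 (Δ, b-invariants),
  III.1.4, VII.2.1–2.2, VII.6.1, VII.6.3 (`SilvermanAEC2009`).
* M. Bhargava, A. Shankar, Ann. of Math. 181 (2015), Lemma 5.16 (= arXiv:1006.1002v2 numbering)
  (`BhargavaShankarAnnals2015`); A. Brumer, K. Kramer, Duke Math. J. 44 (1977), 715–743.
-/

noncomputable section

namespace WeierstrassCurve

open scoped Classical
open Filter Literature.NumberTheory.EllipticCurves
open scoped Topology

/-! ### `Δ ∈ (a₃, a₄, a₆)`: the discriminant is small where both partial derivatives are -/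

section Discriminant

variable {R : Type*} [CommRing R]

/-- **`Δ = a₃·X + a₄·Y + a₆·Z`** with `X, Y, Z ∈ ℤ[a₁, …, a₆]` explicit: the discriminant lies in
the ideal `(a₃, a₄, a₆)` (each of `b₄ = 2a₄ + a₁a₃`, `b₆ = a₃² + 4a₆`, `b₈` does, and
`Δ = -b₂²b₈ - 8b₄³ - 27b₆² + 9b₂b₄b₆`). Applied to the translate of a curve by a point `(x, y)`
(`a₃' = W_Y(x,y)`, `a₄' = -W_X(x,y)`, `a₆' = -W(x,y) = 0`) it bounds `‖Δ‖` by the partial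
derivatives at the point (`norm_Δ_le_max_partial`). [Silverman AEC III.1 (b- and Δ-formulas),
proof of III.1.4] [folklore] -/
theorem Δ_eq_a₃_mul_add_a₄_mul_add_a₆_mul (V : WeierstrassCurve R) :
    V.Δ = V.a₃ * ((V.a₁ ^ 2 + 4 * V.a₂) ^ 2 * (V.a₁ * V.a₄ - V.a₂ * V.a₃) -
        8 * V.a₁ * (2 * V.a₄ + V.a₁ * V.a₃) ^ 2 - 27 * V.a₃ * (V.a₃ ^ 2 + 4 * V.a₆) +
        9 * (V.a₁ ^ 2 + 4 * V.a₂) * (2 * V.a₄ + V.a₁ * V.a₃) * V.a₃) +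
      V.a₄ * ((V.a₁ ^ 2 + 4 * V.a₂) ^ 2 * V.a₄ - 16 * (2 * V.a₄ + V.a₁ * V.a₃) ^ 2) +
      V.a₆ * (-(V.a₁ ^ 2 + 4 * V.a₂) ^ 3 - 108 * (V.a₃ ^ 2 + 4 * V.a₆) +
        36 * (V.a₁ ^ 2 + 4 * V.a₂) * (2 * V.a₄ + V.a₁ * V.a₃)) := by
  simp only [Δ, b₂, b₄, b₆, b₈]; ring

variable {p : ℕ} [Fact p.Prime]

/-- **`‖Δ‖ ≤ max(‖W_Y(x, y)‖, ‖W_X(x, y)‖)` at a point of an equation over `ℤ_p`**: translate the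
point to the origin (`(1, x, 0, y) • V`, Mathlib's `equation_iff_variableChange`); the new
`a₃, a₄` are `W_Y(x,y)`, `-W_X(x,y)`, the new `a₆` vanishes, `Δ` is unchanged, and
`Δ ∈ (a₃, a₄, a₆)`. [Silverman AEC III.1.4 (a Weierstrass curve is singular iff `Δ = 0`)]
[folklore] -/
theorem norm_Δ_le_max_partial (V : WeierstrassCurve ℤ_[p]) {x y : ℤ_[p]}
    (heq : V.toAffine.Equation x y) :
    ‖V.Δ‖ ≤ max ‖2 * y + V.a₁ * x + V.a₃‖ ‖V.a₁ * y - (3 * x ^ 2 + 2 * V.a₂ * x + V.a₄)‖ := by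
  set V' := (⟨1, x, 0, y⟩ : VariableChange ℤ_[p]) • V with hV'
  have hΔ : V'.Δ = V.Δ := by
    rw [hV', variableChange_Δ]; simp
  have ha₃ : V'.a₃ = 2 * y + V.a₁ * x + V.a₃ := by
    rw [hV', variableChange_a₃]; simp only [inv_one, Units.val_one, one_pow, one_mul]; ring
  have ha₄ : V'.a₄ = -(V.a₁ * y - (3 * x ^ 2 + 2 * V.a₂ * x + V.a₄)) := by
    rw [hV', variableChange_a₄]; simp only [inv_one, Units.val_one, one_pow, one_mul]; ring
  have ha₆ : V'.a₆ = 0 := by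
    have h := (Affine.equation_iff_variableChange x y).mp heq
    rw [Affine.equation_zero] at h
    rw [hV']; exact h
  have key := V'.Δ_eq_a₃_mul_add_a₄_mul_add_a₆_mul
  rw [ha₆, zero_mul, add_zero, hΔ] at key
  rw [key, ← ha₃, show V.a₁ * y - (3 * x ^ 2 + 2 * V.a₂ * x + V.a₄) = -V'.a₄ by rw [ha₄, neg_neg],
    norm_neg]
  refine (IsUltrametricDist.norm_add_le_max _ _).trans (max_le_max ?_ ?_)
  · exact (norm_mul_le _ _).trans (mul_le_of_le_one_right (norm_nonneg _) (PadicInt.norm_le_one _))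
  · exact (norm_mul_le _ _).trans (mul_le_of_le_one_right (norm_nonneg _) (PadicInt.norm_le_one _))

/-- **The same over `ℚ_p`**: for a `p`-integral equation and a point `(x, y)` with integral
coordinates, `‖Δ‖ ≤ max(‖W_Y(x,y)‖, ‖W_X(x,y)‖)` — at most one of the two partial derivatives can
be `p`-adically smaller than `Δ`. [Silverman AEC III.1.4, VII.2] [folklore] -/
theorem norm_Δ_le_max_partial_padic (W : WeierstrassCurve ℚ_[p]) [hW : W.IsIntegral ℤ_[p]]
    {x y : ℚ_[p]} (heq : W.toAffine.Equation x y) (hx : ‖x‖ ≤ 1) (hy : ‖y‖ ≤ 1) :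
    ‖W.Δ‖ ≤ max ‖2 * y + W.a₁ * x + W.a₃‖ ‖W.a₁ * y - (3 * x ^ 2 + 2 * W.a₂ * x + W.a₄)‖ := by
  set V := W.integralModel ℤ_[p] with hVdef
  have hV : V.map PadicInt.Coe.ringHom = W := W.eq_map_integralModel
  obtain ⟨x, rfl⟩ : ∃ x' : ℤ_[p], (x' : ℚ_[p]) = x := ⟨⟨x, hx⟩, rfl⟩
  obtain ⟨y, rfl⟩ : ∃ y' : ℤ_[p], (y' : ℚ_[p]) = y := ⟨⟨y, hy⟩, rfl⟩
  have heq' : V.toAffine.Equation x y := by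
    rw [← hV] at heq
    exact (Affine.map_equation (W := V) (f := PadicInt.Coe.ringHom) Subtype.coe_injective x y).mp heq
  have h := V.norm_Δ_le_max_partial heq'
  have hΔ : W.Δ = (V.Δ : ℚ_[p]) := by rw [← hV, map_Δ]; rfl
  have ha₁ : W.a₁ = (V.a₁ : ℚ_[p]) := by rw [← hV, map_a₁]; rfl
  have ha₂ : W.a₂ = (V.a₂ : ℚ_[p]) := by rw [← hV, map_a₂]; rfl
  have ha₃ : W.a₃ = (V.a₃ : ℚ_[p]) := by rw [← hV, map_a₃]; rfl
  have ha₄ : W.a₄ = (V.a₄ : ℚ_[p]) := by rw [← hV, map_a₄]; rfl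
  rw [hΔ, ha₁, ha₂, ha₃, ha₄]
  simp only [PadicInt.norm_def] at h
  push_cast at h
  exact h

end Discriminant

/-! ### Nearby integral points differ by an element of `E⁽ⁿ⁾(ℚ_p)` -/

section IntegralPoints

variable {p : ℕ} [Fact p.Prime] (W : WeierstrassCurve ℚ_[p]) [hW : W.IsIntegral ℤ_[p]]

/-- On a `p`-integral equation, an affine point with `‖x‖ ≤ 1` has `‖y‖ ≤ 1`. [Silverman AEC VII.2]
[folklore] -/
theorem norm_y_le_one {x y : ℚ_[p]} (heq : W.toAffine.Equation x y) (hx : ‖x‖ ≤ 1) : ‖y‖ ≤ 1 :=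
  le_of_not_gt fun hy => not_lt.mpr hx (W.one_lt_norm_x_of_one_lt_norm_y heq hy)

/-- `‖Δ‖ ≤ 1` for a `p`-integral equation. [Silverman AEC VII.1] [folklore] -/
theorem norm_Δ_le_one : ‖W.Δ‖ ≤ 1 := by
  set V := W.integralModel ℤ_[p] with hVdef
  have hV : V.map PadicInt.Coe.ringHom = W := W.eq_map_integralModel
  have hΔ : W.Δ = (V.Δ : ℚ_[p]) := by rw [← hV, map_Δ]; rfl
  rw [hΔ]; exact PadicInt.norm_le_one _

omit hW in
/-- Ultrametric bookkeeping: `‖a‖ < r`, `‖b‖ < r ⇒ ‖a + b‖ < r`. [folklore] -/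
theorem _root_.Literature.NumberTheory.EllipticCurves.padic_norm_add_lt_of_lt {a b : ℚ_[p]} {r : ℝ}
    (ha : ‖a‖ < r) (hb : ‖b‖ < r) : ‖a + b‖ < r :=
  (Padic.nonarchimedean a b).trans_lt (max_lt ha hb)

/-- **The slope of the chord through two nearby integral points is large.** For `P = (x₁, y₁)`,
`Q = (x₂, y₂)` integral on a `p`-integral elliptic curve with `‖x₁ - x₂‖, ‖y₁ - y₂‖ ≤ ε < ‖Δ‖`
and `P ≠ Q`, the line through `P` and `-Q` (the one computing `P - Q`) has slope of norm
`≥ ‖Δ‖/ε`. If `x₁ = x₂` it is the tangent at `P = -Q`, of slope `-W_X(P)/W_Y(P)` with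
`W_Y(P) = y₁ - y₂` small, so `W_X(P)` is not (`norm_Δ_le_max_partial_padic`); if `x₁ ≠ x₂`, with
`u = x₁ - x₂`, `v = y₁ - y₂`, `N = y₁ - (-y₂ - a₁x₂ - a₃) = W_Y(Q) + v` the slope is `N/u`, and
subtracting the two Weierstrass equations gives `N·v = -u·(W_X(Q) + a₁v - (3x₂ + a₂)u - u²)`,
whence `‖N‖ ≥ (‖Δ‖/ε)‖u‖` whether `‖W_Y(Q)‖ ≥ ‖Δ‖` (then `‖N‖ = ‖W_Y(Q)‖`) or not (then
`‖W_X(Q)‖ ≥ ‖Δ‖`). [Silverman AEC VII.2.1 (reduction is a homomorphism; here its quantitative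
germ at a possibly singular reduction)] [folklore] -/
theorem le_norm_slope_of_near [W.IsElliptic] {x₁ y₁ x₂ y₂ : ℚ_[p]}
    (h₁ : W.toAffine.Equation x₁ y₁) (h₂ : W.toAffine.Equation x₂ y₂) (hx₁ : ‖x₁‖ ≤ 1)
    (hy₁ : ‖y₁‖ ≤ 1) (hx₂ : ‖x₂‖ ≤ 1) (hy₂ : ‖y₂‖ ≤ 1) {ε : ℝ} (hε : 0 < ε) (hεΔ : ε < ‖W.Δ‖)
    (hdx : ‖x₁ - x₂‖ ≤ ε) (hdy : ‖y₁ - y₂‖ ≤ ε)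
    (hxy : ¬(x₁ = x₂ ∧ y₁ = W.toAffine.negY x₂ (W.toAffine.negY x₂ y₂))) :
    ‖W.Δ‖ / ε ≤ ‖W.toAffine.slope x₁ x₂ y₁ (W.toAffine.negY x₂ y₂)‖ := by
  obtain ⟨ha₁, ha₂, ha₃, ha₄, ha₆⟩ := W.norm_coeffs_le_one
  have hδ0 : 0 ≤ ‖W.Δ‖ := norm_nonneg _
  have hε1 : ε ≤ 1 := (hεΔ.trans_le W.norm_Δ_le_one).le
  by_cases hx : x₁ = x₂
  · -- the tangent case: `P = -Q`
    have hy : y₁ ≠ y₂ := fun h => hxy ⟨hx, by rwa [Affine.negY_negY]⟩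
    have hyneg : y₁ = W.toAffine.negY x₂ y₂ := by
      rcases Affine.Y_eq_of_X_eq h₁ h₂ hx with h | h
      · exact absurd h hy
      · exact h
    have hnegY₁ : W.toAffine.negY x₁ y₁ = y₂ := by rw [hx, hyneg, Affine.negY_negY]
    have hy' : y₁ ≠ W.toAffine.negY x₂ (W.toAffine.negY x₂ y₂) := by rwa [Affine.negY_negY]
    rw [Affine.slope_of_Y_ne hx hy', hnegY₁]
    have hWY : 2 * y₁ + W.a₁ * x₁ + W.a₃ = y₁ - y₂ := by
      rw [← hnegY₁, Affine.negY]; ring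
    have hWYsmall : ‖2 * y₁ + W.a₁ * x₁ + W.a₃‖ < ‖W.Δ‖ := by rw [hWY]; exact hdy.trans_lt hεΔ
    have hA := W.norm_Δ_le_max_partial_padic h₁ hx₁ hy₁
    have hWX : ‖W.Δ‖ ≤ ‖W.a₁ * y₁ - (3 * x₁ ^ 2 + 2 * W.a₂ * x₁ + W.a₄)‖ :=
      (le_max_iff.mp hA).resolve_left (not_le.mpr hWYsmall)
    rw [norm_div, show 3 * x₁ ^ 2 + 2 * W.a₂ * x₁ + W.a₄ - W.a₁ * y₁ =
      -(W.a₁ * y₁ - (3 * x₁ ^ 2 + 2 * W.a₂ * x₁ + W.a₄)) by ring, norm_neg]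
    exact div_le_div₀ (norm_nonneg _) hWX (norm_pos_iff.mpr (sub_ne_zero.mpr hy)) hdy
  · -- the chord case
    rw [Affine.slope_of_X_ne hx]
    have hu0 : x₁ - x₂ ≠ 0 := sub_ne_zero.mpr hx
    have hupos : 0 < ‖x₁ - x₂‖ := norm_pos_iff.mpr hu0
    have hNeq : y₁ - W.toAffine.negY x₂ y₂ = (2 * y₂ + W.a₁ * x₂ + W.a₃) + (y₁ - y₂) := by
      rw [Affine.negY]; ring
    have key : (y₁ - W.toAffine.negY x₂ y₂) * (y₁ - y₂) =
        -((x₁ - x₂) * ((W.a₁ * y₂ - (3 * x₂ ^ 2 + 2 * W.a₂ * x₂ + W.a₄)) +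
          (W.a₁ * (y₁ - y₂) - (3 * x₂ + W.a₂) * (x₁ - x₂) - (x₁ - x₂) ^ 2))) := by
      rw [Affine.equation_iff] at h₁ h₂
      rw [Affine.negY]
      linear_combination h₁ - h₂
    rw [norm_div, div_le_div_iff₀ hε hupos]
    have hA := W.norm_Δ_le_max_partial_padic h₂ hx₂ hy₂
    by_cases hWY : ‖W.Δ‖ ≤ ‖2 * y₂ + W.a₁ * x₂ + W.a₃‖
    · have hvlt : ‖y₁ - y₂‖ < ‖2 * y₂ + W.a₁ * x₂ + W.a₃‖ := (hdy.trans_lt hεΔ).trans_le hWY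
      have hNnorm : ‖y₁ - W.toAffine.negY x₂ y₂‖ = ‖2 * y₂ + W.a₁ * x₂ + W.a₃‖ := by
        rw [hNeq, Padic.add_eq_max_of_ne hvlt.ne', max_eq_left hvlt.le]
      rw [hNnorm]
      calc ‖W.Δ‖ * ‖x₁ - x₂‖ ≤ ‖W.Δ‖ * ε := by gcongr
        _ ≤ ‖2 * y₂ + W.a₁ * x₂ + W.a₃‖ * ε := by gcongr
    · push Not at hWY
      have hWX : ‖W.Δ‖ ≤ ‖W.a₁ * y₂ - (3 * x₂ ^ 2 + 2 * W.a₂ * x₂ + W.a₄)‖ :=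
        (le_max_iff.mp hA).resolve_left (not_le.mpr hWY)
      have h3 : ‖(3 : ℚ_[p]) * x₂ + W.a₂‖ ≤ 1 := by
        refine BinaryQuartic.norm_add_le_of_le' ?_ ha₂
        rw [norm_mul]
        have : ‖(3 : ℚ_[p])‖ ≤ 1 := by simpa using Padic.norm_int_le_one (p := p) 3
        exact mul_le_one₀ this (norm_nonneg _) hx₂
      have hjunk : ‖W.a₁ * (y₁ - y₂) - (3 * x₂ + W.a₂) * (x₁ - x₂) - (x₁ - x₂) ^ 2‖ ≤ ε := by
        rw [sub_eq_add_neg, sub_eq_add_neg]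
        refine BinaryQuartic.norm_add_le_of_le' (BinaryQuartic.norm_add_le_of_le' ?_ ?_) ?_
        · rw [norm_mul]; exact (mul_le_of_le_one_left (norm_nonneg _) ha₁).trans hdy
        · rw [norm_neg, norm_mul]; exact (mul_le_of_le_one_left (norm_nonneg _) h3).trans hdx
        · rw [norm_neg, norm_pow, pow_two]
          exact (mul_le_mul hdx hdx (norm_nonneg _) hε.le).trans (mul_le_of_le_one_right hε.le hε1)
      have hGnorm : ‖(W.a₁ * y₂ - (3 * x₂ ^ 2 + 2 * W.a₂ * x₂ + W.a₄)) +
          (W.a₁ * (y₁ - y₂) - (3 * x₂ + W.a₂) * (x₁ - x₂) - (x₁ - x₂) ^ 2)‖ =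
          ‖W.a₁ * y₂ - (3 * x₂ ^ 2 + 2 * W.a₂ * x₂ + W.a₄)‖ := by
        have hlt := hjunk.trans_lt (hεΔ.trans_le hWX)
        rw [Padic.add_eq_max_of_ne hlt.ne', max_eq_left hlt.le]
      have hnormeq : ‖y₁ - W.toAffine.negY x₂ y₂‖ * ‖y₁ - y₂‖ =
          ‖x₁ - x₂‖ * ‖W.a₁ * y₂ - (3 * x₂ ^ 2 + 2 * W.a₂ * x₂ + W.a₄)‖ := by
        rw [← norm_mul, key, norm_neg, norm_mul, hGnorm]
      calc ‖W.Δ‖ * ‖x₁ - x₂‖ ≤ ‖W.a₁ * y₂ - (3 * x₂ ^ 2 + 2 * W.a₂ * x₂ + W.a₄)‖ * ‖x₁ - x₂‖ := by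
            gcongr
        _ = ‖y₁ - W.toAffine.negY x₂ y₂‖ * ‖y₁ - y₂‖ := by rw [hnormeq, mul_comm]
        _ ≤ ‖y₁ - W.toAffine.negY x₂ y₂‖ * ε := by gcongr

/-- **Nearby integral points differ by an element of `E⁽ⁿ⁾(ℚ_p)`.** If `P = (x₁, y₁)`, `Q = (x₂, y₂)`
are integral points of a `p`-integral elliptic curve with `‖x₁ - x₂‖, ‖y₁ - y₂‖ ≤ ‖Δ‖·p⁻ⁿ⁻¹`,
then `P = Q` or `P - Q ∈ E₁(ℚ_p)` with `‖z(P - Q)‖ ≤ p⁻ⁿ`: the slope `λ` of the line computing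
`P - Q` has `‖λ‖ ≥ pⁿ⁺¹ > 1` (`le_norm_slope_of_near`), so `x(P - Q) = λ² + a₁λ - a₂ - x₁ - x₂` has
norm `‖λ‖²` and `‖z(P - Q)‖ = ‖λ‖⁻¹`. (This is the statement "points with the same reduction
modulo a high power of `p` are congruent modulo `E⁽ⁿ⁾`", proved directly on the addition formulas,
valid also at points of singular reduction.) [Silverman AEC VII.2.1, VII.6.3] [folklore] -/
theorem some_sub_some_mem_formalFiltration [W.IsElliptic] (n : ℕ) {x₁ y₁ x₂ y₂ : ℚ_[p]}
    (h₁ : W.toAffine.Nonsingular x₁ y₁) (h₂ : W.toAffine.Nonsingular x₂ y₂) (hx₁ : ‖x₁‖ ≤ 1)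
    (hx₂ : ‖x₂‖ ≤ 1) (hdx : ‖x₁ - x₂‖ ≤ ‖W.Δ‖ * ((p : ℝ)⁻¹) ^ (n + 1))
    (hdy : ‖y₁ - y₂‖ ≤ ‖W.Δ‖ * ((p : ℝ)⁻¹) ^ (n + 1)) :
    (Affine.Point.some x₁ y₁ h₁ - Affine.Point.some x₂ y₂ h₂) ∈ W.formalFiltration n := by
  obtain ⟨ha₁, ha₂, -, -, -⟩ := W.norm_coeffs_le_one
  have hy₁ := W.norm_y_le_one h₁.1 hx₁
  have hy₂ := W.norm_y_le_one h₂.1 hx₂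
  have hp := (Fact.out : p.Prime)
  have hpR : (0 : ℝ) < p := by exact_mod_cast hp.pos
  have hpR1 : (1 : ℝ) < p := by exact_mod_cast hp.one_lt
  have hp0' : (0 : ℝ) ≤ (p : ℝ)⁻¹ := inv_nonneg.mpr hpR.le
  have hp1 : (p : ℝ)⁻¹ < 1 := inv_lt_one_of_one_lt₀ hpR1
  have hΔne : W.Δ ≠ 0 := W.coe_Δ' ▸ W.Δ'.ne_zero
  have hΔ0 : 0 < ‖W.Δ‖ := norm_pos_iff.mpr hΔne
  set ε := ‖W.Δ‖ * ((p : ℝ)⁻¹) ^ (n + 1) with hεdef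
  have hε : 0 < ε := mul_pos hΔ0 (pow_pos (inv_pos.mpr hpR) _)
  have hεΔ : ε < ‖W.Δ‖ := mul_lt_of_lt_one_right hΔ0 (pow_lt_one₀ hp0' hp1 (by omega))
  have hK : ‖W.Δ‖ / ε = (p : ℝ) ^ (n + 1) := by
    rw [hεdef, ← div_div, div_self hΔ0.ne', one_div, inv_pow, inv_inv]
  rw [sub_eq_add_neg, Affine.Point.neg_some]
  by_cases hxy : x₁ = x₂ ∧ y₁ = W.toAffine.negY x₂ (W.toAffine.negY x₂ y₂)
  · rw [Affine.Point.add_of_Y_eq hxy.1 hxy.2]; exact zero_mem _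
  rw [Affine.Point.add_some hxy]
  set ℓ := W.toAffine.slope x₁ x₂ y₁ (W.toAffine.negY x₂ y₂) with hℓ
  have hℓge : (p : ℝ) ^ (n + 1) ≤ ‖ℓ‖ :=
    hK ▸ W.le_norm_slope_of_near h₁.1 h₂.1 hx₁ hy₁ hx₂ hy₂ hε hεΔ hdx hdy hxy
  have hℓ1 : 1 < ‖ℓ‖ := (one_lt_pow₀ hpR1 (by omega)).trans_le hℓge
  have hℓ0 : 0 < ‖ℓ‖ := one_pos.trans hℓ1
  have hℓ2 : 1 < ‖ℓ‖ ^ 2 := one_lt_pow₀ hℓ1 two_ne_zero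
  have hℓℓ : ‖ℓ‖ < ‖ℓ‖ ^ 2 := by rw [pow_two]; exact lt_mul_left hℓ0 hℓ1
  -- `‖x(P - Q)‖ = ‖λ‖²`
  have hX : ‖W.toAffine.addX x₁ x₂ ℓ‖ = ‖ℓ‖ ^ 2 := by
    have hrest : ‖W.a₁ * ℓ + -W.a₂ + -x₁ + -x₂‖ < ‖ℓ ^ 2‖ := by
      rw [norm_pow]
      refine padic_norm_add_lt_of_lt (padic_norm_add_lt_of_lt (padic_norm_add_lt_of_lt ?_ ?_) ?_) ?_
      · rw [norm_mul]; exact (mul_le_of_le_one_left (norm_nonneg _) ha₁).trans_lt hℓℓ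
      · rw [norm_neg]; exact ha₂.trans_lt hℓ2
      · rw [norm_neg]; exact hx₁.trans_lt hℓ2
      · rw [norm_neg]; exact hx₂.trans_lt hℓ2
    rw [Affine.addX, show ℓ ^ 2 + W.toAffine.a₁ * ℓ - W.toAffine.a₂ - x₁ - x₂ =
      ℓ ^ 2 + (W.a₁ * ℓ + -W.a₂ + -x₁ + -x₂) by simp only [sub_eq_add_neg, add_assoc],
      Padic.add_eq_max_of_ne hrest.ne', max_eq_left hrest.le, norm_pow]
  have hX1 : 1 < ‖W.toAffine.addX x₁ x₂ ℓ‖ := by rw [hX]; exact hℓ2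
  refine ⟨(W.isInReductionKernel_some _).mpr hX1, ?_⟩
  rw [W.formalParameter_some]
  have heq₃ : W.toAffine.Equation (W.toAffine.addX x₁ x₂ ℓ) (W.toAffine.addY x₁ x₂ y₁ ℓ) :=
    (Affine.nonsingular_add h₁ ((Affine.nonsingular_neg x₂ y₂).mpr h₂) hxy).1
  have hsq := W.norm_formalParameter_sq heq₃ hX1
  have hz : ‖-W.toAffine.addX x₁ x₂ ℓ / W.toAffine.addY x₁ x₂ y₁ ℓ‖ ≤ ((p : ℝ)⁻¹) ^ (n + 1) := by
    rw [← pow_le_pow_iff_left₀ (norm_nonneg _) (pow_nonneg hp0' _) two_ne_zero, hsq, hX, inv_pow,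
      inv_pow]
    exact inv_anti₀ (pow_pos (pow_pos hpR _) 2) (pow_le_pow_left₀ (pow_nonneg hpR.le _) hℓge 2)
  exact hz.trans (pow_le_pow_of_le_one hp0' hp1.le (Nat.le_succ n))

end IntegralPoints

/-! ### Finite index -/

section FiniteIndex

/-- **Coset criterion for finite index**: if a map to a finite type has all its fibres inside
cosets of `H` (`Φ a = Φ b ⇒ a - b ∈ H`), then `H` has finite index (the quotient injects into the
target). [folklore] -/
theorem _root_.Literature.NumberTheory.EllipticCurves.addSubgroup_finiteIndex_of_fibers
    {G : Type*} [AddCommGroup G] (H : AddSubgroup G) {α : Type*} [Finite α] (Φ : G → α)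
    (hΦ : ∀ a b, Φ a = Φ b → a - b ∈ H) : H.FiniteIndex := by
  haveI : Finite (G ⧸ H) := by
    refine Finite.of_injective (fun q : G ⧸ H => Φ q.out) fun q₁ q₂ h => ?_
    have hmem := hΦ _ _ h
    rw [← QuotientAddGroup.out_eq' q₁, ← QuotientAddGroup.out_eq' q₂, QuotientAddGroup.eq]
    rw [show -q₁.out + q₂.out = -(q₁.out - q₂.out) by abel]
    exact H.neg_mem hmem
  exact AddSubgroup.finiteIndex_of_finite_quotient

variable {p : ℕ} [Fact p.Prime] (W : WeierstrassCurve ℚ_[p]) [hW : W.IsIntegral ℤ_[p]]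
  [W.IsElliptic]

omit hW [W.IsElliptic] in
/-- Elements of `ℤ_p` with the same residue modulo `pᵏ` are `pᵏ`-close. [folklore] -/
theorem _root_.Literature.NumberTheory.EllipticCurves.norm_sub_le_of_toZModPow_eq (k : ℕ)
    {a b : ℤ_[p]} (h : PadicInt.toZModPow k a = PadicInt.toZModPow k b) :
    ‖(a : ℚ_[p]) - b‖ ≤ ((p : ℝ)⁻¹) ^ k := by
  have hk : a - b ∈ RingHom.ker (PadicInt.toZModPow k) := by
    rw [RingHom.mem_ker, map_sub, h, sub_self]
  rw [PadicInt.ker_toZModPow, ← PadicInt.norm_le_pow_iff_mem_span_pow] at hk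
  rw [← PadicInt.coe_sub, PadicInt.padic_norm_e_of_padicInt]
  rwa [zpow_neg, zpow_natCast, ← inv_pow] at hk

/-- Two points of `E₁(ℚ_p)` with `pⁿ`-close parameters differ by an element of `E⁽ⁿ⁾`
(`‖z(P - Q)‖ ≤ ‖z(P) - z(Q)‖`). [Silverman AEC IV.3.2(a), VII.2.2] [folklore] -/
theorem sub_mem_formalFiltration_of_norm_sub_le {n : ℕ} {P Q : W.toAffine.Point}
    (hP : W.IsInReductionKernel P) (hQ : W.IsInReductionKernel Q)
    (h : ‖W.formalParameter P - W.formalParameter Q‖ ≤ ((p : ℝ)⁻¹) ^ n) :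
    P - Q ∈ W.formalFiltration n := by
  refine ⟨?_, (W.norm_formalParameter_sub_le hP hQ).trans h⟩
  exact (W.mem_formalFiltration_zero_iff).mp (sub_mem ((W.mem_formalFiltration_zero_iff).mpr hP)
    ((W.mem_formalFiltration_zero_iff).mpr hQ))

/-- **`E⁽ⁿ⁾(ℚ_p)` has finite index in `E(ℚ_p)`** (`p`-integral elliptic curve, any `n`). The map
sending `P ∈ E₁(ℚ_p)` to `z(P) mod pⁿ` and an integral point `(x, y)` to `(x, y) mod p^M`
(`p⁻ᴹ < ‖Δ‖p⁻ⁿ⁻¹`) takes finitely many values and its fibres lie in cosets of `E⁽ⁿ⁾`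
(`sub_mem_formalFiltration_of_norm_sub_le`, `some_sub_some_mem_formalFiltration`). This replaces
the chain `E(K) ⊃ E₀(K) ⊃ E₁(K)` of AEC VII.6.3's proof (finiteness of `E(K)/E₀(K)` by VII.6.1 /
compactness, `E₀/E₁ ≅ Ẽ_ns(k)` by VII.2.1) by one elementary estimate.
[Silverman AEC VII.6.3 (proof), VII.2.1, VII.6.1] [cite: SilvermanAEC2009, VII.6.3] -/
theorem finiteIndex_formalFiltration (n : ℕ) : (W.formalFiltration n).FiniteIndex := by
  have hp := (Fact.out : p.Prime)
  have hpR : (0 : ℝ) < p := by exact_mod_cast hp.pos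
  have hp0' : (0 : ℝ) ≤ (p : ℝ)⁻¹ := inv_nonneg.mpr hpR.le
  have hp1 : (p : ℝ)⁻¹ < 1 := inv_lt_one_of_one_lt₀ (by exact_mod_cast hp.one_lt)
  have hΔne : W.Δ ≠ 0 := W.coe_Δ' ▸ W.Δ'.ne_zero
  have hΔ0 : 0 < ‖W.Δ‖ := norm_pos_iff.mpr hΔne
  have hε : 0 < ‖W.Δ‖ * ((p : ℝ)⁻¹) ^ (n + 1) := mul_pos hΔ0 (pow_pos (inv_pos.mpr hpR) _)
  obtain ⟨M, hM⟩ : ∃ M : ℕ, ((p : ℝ)⁻¹) ^ M < ‖W.Δ‖ * ((p : ℝ)⁻¹) ^ (n + 1) :=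
    exists_pow_lt_of_lt_one hε hp1
  haveI : NeZero (p ^ M) := ⟨pow_ne_zero _ hp.ne_zero⟩
  haveI : NeZero (p ^ n) := ⟨pow_ne_zero _ hp.ne_zero⟩
  -- the residue map
  let Φ : W.toAffine.Point → ZMod (p ^ n) ⊕ (ZMod (p ^ M) × ZMod (p ^ M)) ⊕ Unit := fun P =>
    match P with
    | .zero => Sum.inl (PadicInt.toZModPow n 0)
    | .some x y h =>
      if hx : 1 < ‖x‖ then
        Sum.inl (PadicInt.toZModPow n ⟨-x / y, (W.param_facts h.1 hx).2.2.1.le⟩)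
      else if hy : ‖y‖ ≤ 1 then
        Sum.inr (Sum.inl (PadicInt.toZModPow M ⟨x, not_lt.mp hx⟩, PadicInt.toZModPow M ⟨y, hy⟩))
      else Sum.inr (Sum.inr ())
  refine addSubgroup_finiteIndex_of_fibers _ Φ fun P Q hPQ => ?_
  rcases P with _ | ⟨x₁, y₁, h₁⟩ <;> rcases Q with _ | ⟨x₂, y₂, h₂⟩
  · rw [sub_self]; exact zero_mem _
  · by_cases hx₂ : 1 < ‖x₂‖
    · simp only [Φ, dif_pos hx₂, Sum.inl.injEq] at hPQ
      have hE₂ : W.IsInReductionKernel (.some x₂ y₂ h₂) := (W.isInReductionKernel_some h₂).mpr hx₂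
      refine W.sub_mem_formalFiltration_of_norm_sub_le W.isInReductionKernel_zero hE₂ ?_
      rw [show W.formalParameter Affine.Point.zero = ((0 : ℤ_[p]) : ℚ_[p]) from rfl,
        W.formalParameter_some h₂]
      exact norm_sub_le_of_toZModPow_eq n hPQ
    · exfalso
      by_cases hy₂ : ‖y₂‖ ≤ 1 <;> simp [Φ, hx₂, hy₂] at hPQ
  · by_cases hx₁ : 1 < ‖x₁‖
    · simp only [Φ, dif_pos hx₁, Sum.inl.injEq] at hPQ
      have hE₁ : W.IsInReductionKernel (.some x₁ y₁ h₁) := (W.isInReductionKernel_some h₁).mpr hx₁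
      refine W.sub_mem_formalFiltration_of_norm_sub_le hE₁ W.isInReductionKernel_zero ?_
      rw [show W.formalParameter Affine.Point.zero = ((0 : ℤ_[p]) : ℚ_[p]) from rfl,
        W.formalParameter_some h₁]
      exact norm_sub_le_of_toZModPow_eq n hPQ
    · exfalso
      by_cases hy₁ : ‖y₁‖ ≤ 1 <;> simp [Φ, hx₁, hy₁] at hPQ
  · by_cases hx₁ : 1 < ‖x₁‖ <;> by_cases hx₂ : 1 < ‖x₂‖
    · -- both in `E₁(ℚ_p)`
      simp only [Φ, dif_pos hx₁, dif_pos hx₂, Sum.inl.injEq] at hPQ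
      have hE₁ : W.IsInReductionKernel (.some x₁ y₁ h₁) := (W.isInReductionKernel_some h₁).mpr hx₁
      have hE₂ : W.IsInReductionKernel (.some x₂ y₂ h₂) := (W.isInReductionKernel_some h₂).mpr hx₂
      refine W.sub_mem_formalFiltration_of_norm_sub_le hE₁ hE₂ ?_
      rw [W.formalParameter_some h₁, W.formalParameter_some h₂]
      exact norm_sub_le_of_toZModPow_eq n hPQ
    · exfalso
      by_cases hy₂ : ‖y₂‖ ≤ 1 <;> simp [Φ, hx₁, hx₂, hy₂] at hPQ
    · exfalso
      by_cases hy₁ : ‖y₁‖ ≤ 1 <;> simp [Φ, hx₁, hx₂, hy₁] at hPQ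
    · -- both integral
      have hx₁' : ‖x₁‖ ≤ 1 := not_lt.mp hx₁
      have hx₂' : ‖x₂‖ ≤ 1 := not_lt.mp hx₂
      have hy₁ : ‖y₁‖ ≤ 1 := W.norm_y_le_one h₁.1 hx₁'
      have hy₂ : ‖y₂‖ ≤ 1 := W.norm_y_le_one h₂.1 hx₂'
      simp only [Φ, dif_neg hx₁, dif_neg hx₂, dif_pos hy₁, dif_pos hy₂, Sum.inr.injEq,
        Sum.inl.injEq, Prod.mk.injEq] at hPQ
      refine W.some_sub_some_mem_formalFiltration n h₁ h₂ hx₁' hx₂' ?_ ?_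
      · exact (norm_sub_le_of_toZModPow_eq M hPQ.1).trans hM.le
      · exact (norm_sub_le_of_toZModPow_eq M hPQ.2).trans hM.le

end FiniteIndex

/-! ### Silverman AEC VII.6.3 and Bhargava–Shankar Lemma 5.16 -/

section Assembly

variable {p : ℕ} [Fact p.Prime]

/-- **AEC VII.6.3 for a `p`-integral equation**: `E⁽²⁾(ℚ_p)` is a finite-index subgroup of
`E(ℚ_p)` additively isomorphic to `ℤ_p`. [cite: SilvermanAEC2009, VII.6.3] -/
theorem exists_finiteIndex_addEquiv_padicInt_of_isIntegral (W : WeierstrassCurve ℚ_[p])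
    [W.IsIntegral ℤ_[p]] [W.IsElliptic] :
    ∃ A : AddSubgroup W.toAffine.Point, A.FiniteIndex ∧ Nonempty (A ≃+ ℤ_[p]) :=
  ⟨W.formalFiltration 2, W.finiteIndex_formalFiltration 2,
    W.nonempty_formalFiltration_addEquiv_padicInt le_rfl⟩

/-- Transport of "has a finite-index subgroup `≅ T`" along an additive isomorphism. [folklore] -/
theorem _root_.Literature.NumberTheory.EllipticCurves.exists_finiteIndex_addEquiv_of_addEquiv
    {G G' T : Type*} [AddCommGroup G] [AddCommGroup G'] [AddCommGroup T] (f : G ≃+ G')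
    (h : ∃ A : AddSubgroup G', A.FiniteIndex ∧ Nonempty (A ≃+ T)) :
    ∃ A : AddSubgroup G, A.FiniteIndex ∧ Nonempty (A ≃+ T) := by
  obtain ⟨A, hA, ⟨e⟩⟩ := h
  refine ⟨A.comap f.toAddMonoidHom, ?_, ⟨AddEquiv.trans ?_ e⟩⟩
  · rw [AddSubgroup.finiteIndex_iff, AddSubgroup.index_comap_of_surjective _ f.surjective]
    exact hA.index_ne_zero
  · exact
      { toFun := fun a => ⟨f a, a.2⟩
        invFun := fun b => ⟨f.symm b, by
          show f.toAddMonoidHom (f.symm b) ∈ A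
          rw [AddEquiv.coe_toAddMonoidHom, AddEquiv.apply_symm_apply]; exact b.2⟩
        left_inv := fun a => by ext; simp
        right_inv := fun b => by ext; simp
        map_add' := fun a b => Subtype.ext (map_add f (a : G) b) }

/-- **Discharge of `exists_finiteIndex_addEquiv_padicInt` (Silverman AEC Prop. VII.6.3 for
`K = ℚ_p`)**: for every elliptic curve over `ℚ_p`, `E(ℚ_p)` has a subgroup of finite index
additively isomorphic to `ℤ_p`. Reduction to a `p`-integral equation by a scaling
(Mathlib `exists_isIntegral`; the groups of points are identified by the tree's
`VariableChange.pointEquiv`), then `exists_finiteIndex_addEquiv_padicInt_of_isIntegral`.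
[cite: SilvermanAEC2009, VII.6.3] -/
theorem _root_.Literature.NumberTheory.EllipticCurves.exists_finiteIndex_addEquiv_padicInt_holds :
    exists_finiteIndex_addEquiv_padicInt := by
  intro p _ W _
  obtain ⟨C, hC⟩ := W.exists_isIntegral ℤ_[p]
  exact exists_finiteIndex_addEquiv_of_addEquiv (VariableChange.pointEquiv W C)
    (exists_finiteIndex_addEquiv_padicInt_of_isIntegral (C • W))

/-- **Bhargava–Shankar Lemma 5.16 (Brumer–Kramer) is now a theorem**: for an elliptic curve `E`
over `ℚ_p`, `#(E(ℚ_p)/2E(ℚ_p)) = c_p · #E(ℚ_p)[2]` with `c₂ = 2` and `c_p = 1` otherwise — the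
tree's derivation `brumerKramer_card_quotient_two_of_AEC` fed with AEC VII.6.3.
[cite: BhargavaShankarAnnals2015, Lemma 5.16 (arXiv:1006.1002v2 numbering)] -/
theorem _root_.Literature.NumberTheory.EllipticCurves.brumerKramer_card_quotient_two_holds :
    brumerKramer_card_quotient_two :=
  brumerKramer_card_quotient_two_of_AEC exists_finiteIndex_addEquiv_padicInt_holds

/-- **Frontier of Bhargava–Shankar Cor. 1.2 after this file**: the average rank bound
`averageRankLE_three_halves` follows from THREE remaining named inputs — Lemma 5.2 (`Sel₂ ↔`
locally soluble binary quartics, `bhargavaShankar_card_selmerTwo_eq_kEquivClassCount`), the sieve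
step of display (31) (`bhargavaShankar_locSolIrredClassCount_asymptotic`) and Thm. 2.1
(`bhargavaShankar_classCount`); Lemma 5.16 is discharged. [cite: BhargavaShankarAnnals2015,
Cor. 1.2 (arXiv:1006.1002v2 numbering)] -/
theorem _root_.Literature.NumberTheory.EllipticCurves.averageRankLE_three_halves_of_three_sieve_facts
    (h52 : bhargavaShankar_card_selmerTwo_eq_kEquivClassCount)
    (hG : bhargavaShankar_locSolIrredClassCount_asymptotic) (h16 : bhargavaShankar_classCount) :
    averageRankLE_three_halves :=
  averageRankLE_three_halves_of_sieve_facts h52 hG h16 brumerKramer_card_quotient_two_holds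

/-- The same for Thm. 1.1 (average size of the `2`-Selmer group is `3`).
[cite: BhargavaShankarAnnals2015, Thm. 1.1 (arXiv:1006.1002v2 numbering)] -/
theorem _root_.Literature.NumberTheory.EllipticCurves.average_card_selmerTwo_of_three_sieve_facts
    (h52 : bhargavaShankar_card_selmerTwo_eq_kEquivClassCount)
    (hG : bhargavaShankar_locSolIrredClassCount_asymptotic) (h16 : bhargavaShankar_classCount) :
    Literature.NumberTheory.EllipticCurves.average_card_selmerTwo :=
  average_card_selmerTwo_of_sieve_facts h52 hG h16 brumerKramer_card_quotient_two_holds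

end Assembly

end WeierstrassCurve
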